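import Literature.NumberTheory.Sieve.ChenTheoremISwitchedCount
import Literature.NumberTheory.Sieve.ChenShiftedSwitchedSieve
import HarnessLib

/-!
# Chen's Theorem II: the count of the enlarged switched index set for a fixed shift `h` — PROVED

Third step of hypothesis (C) of `Literature.NumberTheory.Sieve.Chen.Chen1973_theoremII_of` (after the
sieve step `ChenShiftedSwitchedSieve` and the remainder `ChenShiftedSwitchedRemainder`): the count of
the enlarged index set `T̃(h, N, ε)` (`switchedTriplesS`),

  `#T̃(h, N, ε) ≤ (1+ε)² (c₁₀ + η) N/log N`  for all large `N`  (`card_switchedTriplesS_le`),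

`c₁₀ = switchingConstantTenth`. The coprimality conditions (the only place where the shift `h` enters
`T̃`) are discarded at once, so this is `ChenTheoremISwitchedCount.card_switchedTriplesT_le` verbatim
for the other index set: the three counting lemmas that mention the set are transcribed
(`card_switchedTriplesS_le_sum`, `card_le_pnt_sumS`, `card_switchedTriplesS_le`); the analysis
(`inner_appliedT`, `outer_appliedT`, `integral_phiFun_div_tenth`, the prime number theorem step) is
reused from that file. No named facts.

## References

* Chen Jing-run, Sci. Sinica 16 (1973) 157–176, Lemma 8, (27)–(28) (reprint PDF pp. 166–167).
  [ChenSciSinica1973]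
* M. B. Nathanson, *Additive Number Theory: The Classical Bases*, GTM 164 (1996), Thm 10.6 (proof,
  p. 289). [Nathanson1996]
-/

open Finset Filter Topology MeasureTheory

noncomputable section

namespace Literature.NumberTheory.Sieve.Chen

open Literature.NumberTheory.LFunctions.Mertens

/-- **`|B̃| ≤ ∑_{p₁} ∑_{p₂} π((1+ε)N/(p₁p₂))`** (Nathanson p. 289: a triple of `T̃(N, ε)` has
`p₁p₂p₃ < (1+ε)N`, hence `p₁p₂² < (1+ε)N` and `p₃ < (1+ε)N/(p₁p₂)`).
[cite: Nathanson1996, Thm 10.6 (proof, (10.14) and p. 289)] -/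
theorem card_switchedTriplesS_le_sum {h N : ℕ} {ε : ℝ} (hN : 0 < N) (hε : 0 < ε) :
    (#(switchedTriplesS h N ε) : ℝ) ≤
      ∑ p₁ ∈ midPrimes ((N : ℝ) ^ (1 / 10 : ℝ)) (y N), ∑ p₂ ∈ secondPrimes N ε p₁,
        (#(Nat.primesBelow ⌈(1 + ε) * N / (p₁ * p₂)⌉₊) : ℝ) := by
  classical
  set S : Finset (Σ _ : ℕ, Σ _ : ℕ, ℕ) := (midPrimes ((N : ℝ) ^ (1 / 10 : ℝ)) (y N)).sigma fun p₁ =>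
    (secondPrimes N ε p₁).sigma fun p₂ => Nat.primesBelow ⌈(1 + ε) * N / (p₁ * p₂)⌉₊ with hS
  have hcardS : (#S : ℝ) = ∑ p₁ ∈ midPrimes ((N : ℝ) ^ (1 / 10 : ℝ)) (y N), ∑ p₂ ∈ secondPrimes N ε p₁,
      (#(Nat.primesBelow ⌈(1 + ε) * N / (p₁ * p₂)⌉₊) : ℝ) := by
    rw [hS, Finset.card_sigma]
    push_cast
    refine Finset.sum_congr rfl fun p₁ _ => ?_
    rw [Finset.card_sigma]
    push_cast
    rfl
  rw [← hcardS]
  have hN0 : (0 : ℝ) < N := by exact_mod_cast hN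
  refine Nat.cast_le.mpr (Finset.card_le_card_of_injOn
    (fun t : ℕ × ℕ × ℕ => (⟨t.1, ⟨t.2.1, t.2.2⟩⟩ : Σ _ : ℕ, Σ _ : ℕ, ℕ)) (fun t ht => ?_) ?_)
  · rw [Finset.mem_coe] at ht
    obtain ⟨-, h₁, h₂, h₃, hz, hy, hy', h23, -, -, hlt⟩ := mem_switchedTriplesS.mp ht
    rw [Finset.mem_coe, hS, Finset.mem_sigma, Finset.mem_sigma, mem_midPrimes_tenth, mem_secondPrimes,
      Nat.mem_primesBelow, Nat.lt_ceil]
    dsimp only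
    -- `p₁p₂p₃ < (1+ε) N`
    have hℓ := chenGridPointT_pos hN hε t.1
    have hp1 : (t.1 : ℝ) < (1 + ε) * chenGridPointT N ε t.1 := lt_mul_chenGridPointT hN hε hz
    have h2pos : (0 : ℝ) < t.2.1 := by exact_mod_cast h₂.pos
    have h3pos : (0 : ℝ) < t.2.2 := by exact_mod_cast h₃.pos
    have h1pos : (0 : ℝ) < t.1 := by exact_mod_cast h₁.pos
    have hprod : (t.1 : ℝ) * t.2.1 * t.2.2 < (1 + ε) * N := by
      calc (t.1 : ℝ) * t.2.1 * t.2.2 = (t.1 : ℝ) * ((t.2.1 : ℝ) * t.2.2) := by ring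
        _ < (1 + ε) * chenGridPointT N ε t.1 * ((t.2.1 : ℝ) * t.2.2) := by gcongr
        _ = (1 + ε) * (chenGridPointT N ε t.1 * t.2.1 * t.2.2) := by ring
        _ < (1 + ε) * N := by gcongr
    have h23' : (t.2.1 : ℝ) ≤ t.2.2 := by exact_mod_cast h23
    refine ⟨⟨h₁, hz, hy⟩, ⟨h₂, hy', ?_⟩, ?_, h₃⟩
    · -- `p₂ < √((1+ε)N/p₁)`
      rw [Real.lt_sqrt h2pos.le, lt_div_iff₀ h1pos]
      calc (t.2.1 : ℝ) ^ 2 * t.1 = t.1 * t.2.1 * t.2.1 := by ring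
        _ ≤ t.1 * t.2.1 * t.2.2 := by gcongr
        _ < (1 + ε) * N := hprod
    · -- `p₃ < (1+ε)N/(p₁p₂)`
      rw [lt_div_iff₀ (by positivity)]
      linarith [hprod]
  · intro t _ t' _ heq
    simp only [Sigma.mk.injEq, heq_eq_eq] at heq
    obtain ⟨h1, h2, h3⟩ := heq
    exact Prod.ext h1 (Prod.ext h2 h3)


/-- **The prime number theorem step** (Nathanson p. 289: `π((1+ε)N/(p₁p₂)) <
(1+2ε)N/(p₁p₂ log(N/p₁p₂))` for `N ≥ N(ε)`): if `#{p < x} ≤ (1+κ)x/log x` for all `x ≥ x₀` and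
`N^{1/3} ≥ x₀ ≥ 3`, then with `X' = (1+ε)N`, `L' = log X'`, `u_i = log p_i/L'`,
`#T̃(N, ε) ≤ (1+κ)(X'/L') ∑_{p₁} p₁⁻¹ ∑_{p₂} p₂⁻¹/(1 − u₁ − u₂)`
(`log(X'/(p₁p₂)) = L'(1 − u₁ − u₂) > 0` as `X'/(p₁p₂) > (X'/p₁)^{1/2} > N^{1/3}`).
[cite: Nathanson1996, Thm 10.6 (proof, p. 289)] -/
theorem card_le_pnt_sumS {h N : ℕ} {ε κ x₀ : ℝ} (hN : 2 ≤ N) (hε : 0 < ε) (hx₀3 : 3 ≤ x₀)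
    (hPNT : ∀ x : ℝ, x₀ ≤ x → (#(Nat.primesBelow ⌈x⌉₊) : ℝ) ≤ (1 + κ) * x / Real.log x)
    (hNx₀ : x₀ ≤ (N : ℝ) ^ (1 / 3 : ℝ)) (hκ : 0 ≤ κ) :
    (#(switchedTriplesS h N ε) : ℝ) ≤
      (1 + κ) * ((1 + ε) * N / Real.log ((1 + ε) * N)) *
        ∑ p₁ ∈ midPrimes ((N : ℝ) ^ (1 / 10 : ℝ)) (y N), (p₁ : ℝ)⁻¹ * ∑ p₂ ∈ secondPrimes N ε p₁,
          (p₂ : ℝ)⁻¹ * (1 / ((1 - Real.log p₁ / Real.log ((1 + ε) * N)) -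
            Real.log p₂ / Real.log ((1 + ε) * N))) := by
  have hNpos : 0 < N := by omega
  have hN0 : (0 : ℝ) < N := by exact_mod_cast hNpos
  have hN1 : (1 : ℝ) < N := by exact_mod_cast (show 1 < N by omega)
  set X' : ℝ := (1 + ε) * N with hX'
  have hX'N : (N : ℝ) ≤ X' := by rw [hX']; nlinarith
  have hX'0 : 0 < X' := by positivity
  have hX'1 : 1 < X' := by linarith
  set L' : ℝ := Real.log X' with hL'
  have hL'0 : 0 < L' := Real.log_pos hX'1
  refine (card_switchedTriplesS_le_sum hNpos hε).trans ?_
  rw [Finset.mul_sum]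
  refine Finset.sum_le_sum fun p₁ hp₁ => ?_
  rw [Finset.mul_sum, Finset.mul_sum]
  refine Finset.sum_le_sum fun p₂ hp₂ => ?_
  obtain ⟨hp₁prime, hz₁, hy₁⟩ := mem_midPrimes_tenth.mp hp₁
  obtain ⟨hp₂prime, hy₂, hsq₂⟩ := mem_secondPrimes.mp hp₂
  have hp₁0 : (0 : ℝ) < p₁ := by exact_mod_cast hp₁prime.pos
  have hp₂0 : (0 : ℝ) < p₂ := by exact_mod_cast hp₂prime.pos
  have hy0 : 0 < y N := Real.rpow_pos_of_pos hN0 _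
  -- `x = X'/(p₁p₂) ≥ N^{1/3} ≥ x₀`
  set x : ℝ := X' / (p₁ * p₂) with hxdef
  have hx0 : 0 < x := by positivity
  have hxsq : Real.sqrt (X' / p₁) < x := by
    -- `p₁ p₂ < p₁ √(X'/p₁) = √(p₁ X')`, so `x > X'/√(p₁X') = √(X'/p₁)`
    rw [hxdef, lt_div_iff₀ (by positivity)]
    have h1 : Real.sqrt (X' / p₁) * (p₁ * p₂) < Real.sqrt (X' / p₁) * (p₁ * Real.sqrt (X' / p₁)) := by
      gcongr
    have h2 : Real.sqrt (X' / p₁) * (p₁ * Real.sqrt (X' / p₁)) = X' := by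
      have := Real.mul_self_sqrt (show 0 ≤ X' / p₁ by positivity)
      calc Real.sqrt (X' / p₁) * (p₁ * Real.sqrt (X' / p₁)) = p₁ * (Real.sqrt (X' / p₁) * Real.sqrt (X' / p₁)) := by ring
        _ = p₁ * (X' / p₁) := by rw [this]
        _ = X' := by field_simp
    linarith
  have hxy : y N ≤ Real.sqrt (X' / p₁) := by
    -- `y² = N^{2/3} ≤ N/p₁ ≤ X'/p₁` as `p₁ < y = N^{1/3}`
    rw [Real.le_sqrt' hy0, le_div_iff₀ hp₁0]
    have hy3 : y N ^ 2 * y N = (N : ℝ) := by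
      rw [y, ← Real.rpow_natCast, ← Real.rpow_mul hN0.le, ← Real.rpow_add hN0]
      norm_num
    have hyp : y N ^ 2 * (p₁ : ℝ) ≤ y N ^ 2 * y N :=
      mul_le_mul_of_nonneg_left hy₁.le (by positivity)
    calc y N ^ 2 * (p₁ : ℝ) ≤ y N ^ 2 * y N := hyp
      _ = (N : ℝ) := hy3
      _ ≤ X' := hX'N
  have hxx₀ : x₀ ≤ x := by linarith [hNx₀.trans hxy]
  have hx1 : 1 < x := by linarith
  -- the logarithm
  have hlogx : Real.log x = L' * ((1 - Real.log p₁ / L') - Real.log p₂ / L') := by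
    rw [hxdef, Real.log_div hX'0.ne' (by positivity), Real.log_mul hp₁0.ne' hp₂0.ne']
    field_simp
    ring
  have hlogx0 : 0 < Real.log x := Real.log_pos hx1
  have hden : 0 < (1 - Real.log p₁ / L') - Real.log p₂ / L' := by
    have := hlogx0; rw [hlogx] at this
    exact pos_of_mul_pos_right this hL'0.le |> fun _hpos => by
      rcases lt_trichotomy ((1 - Real.log p₁ / L') - Real.log p₂ / L') 0 with h' | h' | h'
      · nlinarith
      · rw [h', mul_zero] at this; exact absurd this (lt_irrefl 0)
      · exact h'
  -- PNT
  have hpnt := hPNT x hxx₀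
  refine hpnt.trans (le_of_eq ?_)
  rw [hlogx, hxdef]
  field_simp


set_option maxHeartbeats 800000 in

/-- **The cardinality of `B̃` at `z = N^{1/10}`** (Chen's (28): the double prime sum is
`≤ (1 + o(1)) c₁₀/log N`, `c₁₀ = ∫_{1/10}^{1/3} log(2−3β)/(β(1−β)) dβ`): for `0 < ε ≤ 1` and every `η > 0`, for all large `N`,
`#T̃(N, ε) ≤ (1+ε)² (c + η) N/log N`.
The prime number theorem (upper bound, `exists_card_primesBelow_ceil_le`) counts `p₃`; the sums over
`p₂` and `p₁` are compared with the integrals through Mertens' theorem on the windows of a grid in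
logarithmic scale (`inner_applied`, `outer_applied`), and the double integral is `c`
(`integral_phiFun_div_tenth`). [cite: ChenSciSinica1973, Lemma 8 eq. (27)–(28)] -/
theorem card_switchedTriplesS_le {h : ℕ} {ε : ℝ} (hε : 0 < ε) (hε1 : ε ≤ 1) {η : ℝ} (hη : 0 < η) :
    ∀ᶠ N : ℕ in atTop,
      (#(switchedTriplesS h N ε) : ℝ) ≤ (1 + ε) ^ 2 * (switchingConstantTenth + η) * N / Real.log N := by
  obtain ⟨x₀, hx₀⟩ := exists_card_primesBelow_ceil_le hε
  set x₁ : ℝ := max x₀ 3 with hx₁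
  have hx₁3 : 3 ≤ x₁ := le_max_right _ _
  have hPNT : ∀ x : ℝ, x₁ ≤ x → (#(Nat.primesBelow ⌈x⌉₊) : ℝ) ≤ (1 + ε) * x / Real.log x :=
    fun x hx => hx₀ x (le_trans (le_max_left _ _) hx)
  -- the mesh
  set m : ℕ := ⌈196 / η⌉₊ + 1 with hmdef
  have hm1 : 1 ≤ m := by omega
  have hm0 : (0 : ℝ) < m := by exact_mod_cast hm1
  have hmη : 49 / (m : ℝ) ≤ η / 4 := by
    have h1 : 196 / η ≤ m := by
      rw [hmdef]; push_cast
      exact (Nat.le_ceil _).trans (by linarith)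
    rw [div_le_iff₀ hm0]
    rw [div_le_iff₀ hη] at h1
    linarith
  -- eventual conditions
  have hlog : Tendsto (fun N : ℕ => Real.log N) atTop atTop :=
    Real.tendsto_log_atTop.comp (tendsto_natCast_atTop_atTop (R := ℝ))
  have hcube : Tendsto (fun N : ℕ => ((N : ℝ)) ^ (1 / 3 : ℝ)) atTop atTop :=
    (tendsto_rpow_atTop (by norm_num : (0 : ℝ) < 1 / 3)).comp (tendsto_natCast_atTop_atTop (R := ℝ))
  filter_upwards [eventually_ge_atTop (6 ^ 10), hlog.eventually_ge_atTop 180,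
    hlog.eventually_ge_atTop (4 * 1266 * m / η), hcube.eventually_ge_atTop x₁] with N hN hL136 hLm hNx₁
  have hN2 : 2 ≤ N := le_trans (by norm_num) hN
  have hN0 : (0 : ℝ) < N := by exact_mod_cast (show 0 < N by omega)
  obtain ⟨hX'1, hLL', hL'L⟩ := log_enlarged_bounds hN2 hε hε1
  set X' : ℝ := (1 + ε) * N with hX'
  set L' : ℝ := Real.log X' with hL'def
  set L : ℝ := Real.log N with hLdef
  have hL0 : 0 < L := by linarith
  have hL'0 : 0 < L' := by linarith
  have hL15 : 15 ≤ L := by linarith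
  -- Step 1: PNT
  have h1 := card_le_pnt_sumS (h := h) hN2 hε hx₁3 hPNT hNx₁ hε.le
  rw [← hX', ← hL'def] at h1
  -- Step 2: the inner sums
  set ρ : ℝ := 8 / m + 272 * m / L' with hρ
  have hρ0 : 0 ≤ ρ := by positivity
  have h2 : ∑ p₁ ∈ midPrimes ((N : ℝ) ^ (1 / 10 : ℝ)) (y N), (p₁ : ℝ)⁻¹ * ∑ p₂ ∈ secondPrimes N ε p₁,
      (p₂ : ℝ)⁻¹ * (1 / ((1 - Real.log p₁ / L') - Real.log p₂ / L')) ≤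
      ∑ p₁ ∈ midPrimes ((N : ℝ) ^ (1 / 10 : ℝ)) (y N), (p₁ : ℝ)⁻¹ * (phiFun (Real.log p₁ / L') + ρ) := by
    refine Finset.sum_le_sum fun p₁ hp₁ => mul_le_mul_of_nonneg_left ?_ (by positivity)
    have := inner_appliedT hN hε hε1 hL15 hm1 hp₁
    rw [hρ]; linarith
  -- Step 3: the outer sum
  have h3 := outer_appliedT hN hε hε1 hL136 hm1 hρ0
  -- assemble
  have hfac0 : 0 ≤ (1 + ε) * (X' / L') := by positivity
  have hB : switchingConstantTenth + 50 / L' + 25 / m + 400 * m / L' + 3 * ρ ≤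
      switchingConstantTenth + η / 2 := by
    have hm1' : (1 : ℝ) ≤ m := by exact_mod_cast hm1
    -- `49/m ≤ η/4` and `1266 m/L' ≤ η/4`
    have hLm' : 4 * 1266 * m / η ≤ L' := hLm.trans hLL'
    have hsecond : 1266 * m / L' ≤ η / 4 := by
      rw [div_le_iff₀ hL'0]
      rw [div_le_iff₀ hη] at hLm'
      nlinarith
    have e1 : 50 / L' + 400 * m / L' + 3 * (272 * m / L') ≤ 1266 * m / L' := by
      rw [show 50 / L' + 400 * m / L' + 3 * (272 * m / L') = (50 + 1216 * m) / L' by ring]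
      exact div_le_div_of_nonneg_right (by linarith) hL'0.le
    have e2 : 25 / (m : ℝ) + 3 * (8 / m) = 49 / m := by ring
    rw [hρ]
    nlinarith [e1, e2, hmη, hsecond]
  have hXL : X' / L' ≤ (1 + ε) * N / L := by
    rw [div_le_div_iff₀ hL'0 hL0, hX']
    have : 0 ≤ (1 + ε) * (N : ℝ) := by positivity
    nlinarith
  calc (#(switchedTriplesS h N ε) : ℝ)
      ≤ (1 + ε) * (X' / L') * ∑ p₁ ∈ midPrimes ((N : ℝ) ^ (1 / 10 : ℝ)) (y N), (p₁ : ℝ)⁻¹ * ∑ p₂ ∈ secondPrimes N ε p₁,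
          (p₂ : ℝ)⁻¹ * (1 / ((1 - Real.log p₁ / L') - Real.log p₂ / L')) := h1
    _ ≤ (1 + ε) * (X' / L') * ∑ p₁ ∈ midPrimes ((N : ℝ) ^ (1 / 10 : ℝ)) (y N), (p₁ : ℝ)⁻¹ * (phiFun (Real.log p₁ / L') + ρ) :=
        mul_le_mul_of_nonneg_left h2 hfac0
    _ ≤ (1 + ε) * (X' / L') * (switchingConstantTenth + η / 2) :=
        mul_le_mul_of_nonneg_left (h3.trans hB) hfac0
    _ ≤ (1 + ε) * ((1 + ε) * N / L) * (switchingConstantTenth + η / 2) := by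
        have hc0 : 0 ≤ switchingConstantTenth + η / 2 := by
          have := switchingConstantTenth_nonneg; positivity
        exact mul_le_mul_of_nonneg_right (mul_le_mul_of_nonneg_left hXL (by linarith)) hc0
    _ ≤ (1 + ε) ^ 2 * (switchingConstantTenth + η) * N / L := by
        rw [show (1 + ε) * ((1 + ε) * N / L) * (switchingConstantTenth + η / 2) =
          ((1 + ε) ^ 2 * (switchingConstantTenth + η / 2) * N) / L by ring]
        refine div_le_div_of_nonneg_right ?_ hL0.le
        have : 0 ≤ (1 + ε) ^ 2 * (N : ℝ) := by positivity
        nlinarith [switchingConstantTenth_nonneg]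



end Literature.NumberTheory.Sieve.Chen
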